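import Mathlib
import HarnessLib
import Summits.ResolutionOfSingularities.ResolutionOfSingularities.Theorems.WildQuotientsWildQuotientResolutionS1aKillFreeShots
import Summits.ResolutionOfSingularities.ResolutionOfSingularities.Theorems.WildQuotientsWildQuotientResolutionS1aGoodOfKilledNode
import Summits.ResolutionOfSingularities.ResolutionOfSingularities.Theorems.WildQuotientsWildQuotientResolutionS1aTameRootChartOfRegular

/-!
# S1a — the TERMINAL CASE of the research stub: a terminal model inhabits `ReachLowerInF(X)` with the empty tree; terminal recognition of the INITIAL model from a global chart

[OURS · L1 W4.5c · leafhand-res-wildquotients-9 g1; SUCCESSOR-BRIEF-v2 §2 optional item I-7 (`reachLowerFX_of_terminal` +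
`terminal_initial_of_isRegular_invariants`), caveat E-T of §3 («data with regular/tame invariant ring are terminal at move 0»)] — NOT
statements of the manuscript; counted 0; AI-level work, weaker than expert review. Crux stmt-ResolutionOfSingularities-17941
`CyclicQuotientFourfolds`, line `s1a-logminvertex` v13 (`stub_reachLowerInFX`). A (degenerate) CLASS of the research stub, not the stub.

* `exists_reachLowerF_of_terminal` — if `M` is TERMINAL then for every root decoration `𝔄₀` the conclusion of `ReachLowerInF(X)` holds at
  `(M, 𝔄₀)` with the class `P := {Terminal}` (vacuously: no member is non-terminal). The `KillsIn`-route (`exists_reachLowerF_of_killsIn`)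
  needs `F = ∅`, which is STRONGER than `Terminal` (caveat E-T: a translation `x₃ ↦ x₃ + f(x₀,x₁,x₂)` has fixed points wherever `f = 0` but
  a regular invariant ring); this lemma is the route for such data.
* `terminal_initial_of_fixedRing` — TERMINAL RECOGNITION OF THE INITIAL MODEL from ONE global chart: `X′` affine, `q` affine, `G = ⟨g₀⟩`,
  `e : Γ(X′, ⊤) ≃+* A₀` intertwining the action of `g₀` (pull-back along `g₀⁻¹`) with a ring endomorphism `σ₀` of `A₀` whose fixed ring
  `{a | σ₀ a = a}` is a tame root chart ⇒ `(initial).Terminal` (bridge ✓`isGoodAt_of_nodeChart_invariants` on the chart `⊤`).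
* `terminal_initial_of_fixedRing_equiv_regular` — the same with the fixed ring RING-ISOMORPHIC TO A REGULAR (Noetherian) ring
  (✓`isTameRootChart_of_isRegularRing`, `m = 0` packaging).
* `exists_reachLowerF_initial_of_fixedRing_equiv_regular` — hence such a datum satisfies the conclusion of `ReachLowerInF(X)` at its
  initial model for EVERY root decoration (instance interface ✓`reachLowerInFX_datum_of_exists`).
-/

set_option linter.dupNamespace false

noncomputable section

open CategoryTheory Limits AlgebraicGeometry TopologicalSpace Topology
open Literature.AlgebraicGeometry.Resolution Literature.AlgebraicGeometry.RelativeSpec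
open Summit.ResolutionOfSingularities.ResolutionOfSingularities.Theorems.WildQuotientResolution.S1
open Summit.ResolutionOfSingularities.ResolutionOfSingularities.Theorems.WildQuotientResolution.S1.NodeAtlas
open Summit.ResolutionOfSingularities.ResolutionOfSingularities.Theorems.WildQuotientResolution.S1.NpFrame

namespace Summit.ResolutionOfSingularities.ResolutionOfSingularities.Theorems.WildQuotientResolution.S1.GameFrame.GModel

variable {p : ℕ} {X' X₁ : Scheme.{0}} {q : X' ⟶ X₁} {G : Type} [Group G] {ρ : G →* Aut X'} {g₀ : G}

/-- **THE TERMINAL CASE OF THE RESEARCH STUB.** If the model `M` is TERMINAL then, for every root decoration `𝔄₀`, the conclusion of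
`ReachLowerInF(X)` holds at `(M, 𝔄₀)`: take the class `P := {Terminal}`; no member of `P` is non-terminal, so there is nothing to reach.
[OURS · L1 W4.5c · I-7; NOT a statement of the manuscript] -/
theorem exists_reachLowerF_of_terminal (M₀ : GModel p q G ρ g₀) (𝔄₀ : NodeAtlasData p M₀.act g₀) (hM₀ : M₀.Terminal) :
    ∃ P : ∀ M : GModel p q G ρ g₀, NodeAtlasData p M.act g₀ → Prop,
      P M₀ 𝔄₀ ∧ ∀ (M : GModel p q G ρ g₀) (𝔄 : NodeAtlasData p M.act g₀), P M 𝔄 → ¬ M.Terminal →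
        ∃ n : ℕ, TreeF P (fun N 𝔅 => LexLTF N 𝔅 M 𝔄) n M 𝔄 :=
  ⟨fun M _ => M.Terminal, hM₀, fun _ _ hP hT => absurd hP hT⟩

/-- **TERMINAL RECOGNITION OF THE INITIAL MODEL FROM ONE GLOBAL CHART.** Let `G = ⟨g₀⟩` act on the AFFINE `X′` over `X₁` through `q` affine,
and let `e : Γ(X′, ⊤) ≃+* A₀` intertwine the action of `g₀` on global sections (pull-back along `g₀⁻¹`, the tree's `ActionOver.act`
convention) with a ring endomorphism `σ₀` of `A₀`. If the FIXED RING `{a | σ₀ a = a}` is a tame root chart, the initial model is TERMINAL: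
the single `G`-stable affine chart `X′` witnesses goodness at every point (✓`isGoodAt_of_nodeChart_invariants`).
[OURS · L1 W4.5c · I-7; NOT a statement of the manuscript] -/
theorem terminal_initial_of_fixedRing [Finite G] (hG : ∀ g : G, g ∈ Subgroup.zpowers g₀)
    (hq : ∀ g : G, (ρ g).hom ≫ q = q) [IsIntegral X'] [IsLocallyNoetherian X'] [IsAffine X'] [IsAffineHom q]
    {A₀ : Type} [CommRing A₀] (e : Γ(X', ⊤) ≃+* A₀) (σ₀ : A₀ →+* A₀)
    (he : ∀ t : Γ(X', ⊤), e ((ρ g₀⁻¹).hom.appLE ⊤ ⊤ (by rw [Scheme.Hom.preimage_top]) t) = σ₀ (e t))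
    (h : IsTameRootChart ↥(RingHom.eqLocus σ₀ (RingHom.id A₀)))
    (h₀ : NodeAtlas p (⟨ρ, hq⟩ : ActionOver q G) g₀) :
    (GModel.initial (p := p) (g₀ := g₀) hq h₀).Terminal := by
  intro v
  haveI : IsAffine (⊤ : X'.Opens) := isAffineOpen_top X'
  have hAff : IsAffineHom ((⊤ : X'.Opens).ι ≫ q) := inferInstance
  have hst : ∀ g : G, (ρ g).hom ⁻¹ᵁ (⊤ : X'.Opens) = ⊤ := fun g => Scheme.Hom.preimage_top _
  let O : (GModel.initial (p := p) (g₀ := g₀) hq h₀).act.StableAffineOpens := ⟨⊤, hst, hAff⟩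
  obtain ⟨O', hv, hO', hT⟩ := (GModel.initial (p := p) (g₀ := g₀) hq h₀).isGoodAt_of_nodeChart_invariants hG v O
    (Opens.mem_top v) (isAffineOpen_top X') e σ₀ (fun t => he t) h
  exact ⟨O', hv, hO', hT⟩

/-- **… with the fixed ring isomorphic to a REGULAR ring.** Same setting; if the fixed ring `{a | σ₀ a = a}` is ring-isomorphic to a regular
(Noetherian) commutative ring `R` — e.g. a polynomial ring over a field — then the initial model is TERMINAL (`m = 0` packaging
✓`isTameRootChart_of_isRegularRing`). This is caveat E-T of the line's brief as a theorem: data whose ring of invariants is regular are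
terminal at move `0`, whatever their fixed locus. [OURS · L1 W4.5c · I-7; NOT a statement of the manuscript] -/
theorem terminal_initial_of_fixedRing_equiv_regular [Finite G] (hG : ∀ g : G, g ∈ Subgroup.zpowers g₀)
    (hq : ∀ g : G, (ρ g).hom ≫ q = q) [IsIntegral X'] [IsLocallyNoetherian X'] [IsAffine X'] [IsAffineHom q]
    {A₀ : Type} [CommRing A₀] (e : Γ(X', ⊤) ≃+* A₀) (σ₀ : A₀ →+* A₀)
    (he : ∀ t : Γ(X', ⊤), e ((ρ g₀⁻¹).hom.appLE ⊤ ⊤ (by rw [Scheme.Hom.preimage_top]) t) = σ₀ (e t))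
    {R : Type} [CommRing R] [IsRegularRing R] (eR : ↥(RingHom.eqLocus σ₀ (RingHom.id A₀)) ≃+* R)
    (h₀ : NodeAtlas p (⟨ρ, hq⟩ : ActionOver q G) g₀) :
    (GModel.initial (p := p) (g₀ := g₀) hq h₀).Terminal :=
  terminal_initial_of_fixedRing hG hq e σ₀ he
    (IsTameRootChart.of_ringEquiv eR (isTameRootChart_of_isRegularRing R inferInstance)) h₀

/-- **Hence such a datum satisfies the conclusion of `ReachLowerInF(X)` at its initial model, for EVERY root decoration `𝔄₀`** (the shape
consumed by ✓`reachLowerInFX_datum_of_exists`). [OURS · L1 W4.5c · I-7; NOT a statement of the manuscript] -/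
theorem exists_reachLowerF_initial_of_fixedRing_equiv_regular [Finite G] (hG : ∀ g : G, g ∈ Subgroup.zpowers g₀)
    (hq : ∀ g : G, (ρ g).hom ≫ q = q) [IsIntegral X'] [IsLocallyNoetherian X'] [IsAffine X'] [IsAffineHom q]
    {A₀ : Type} [CommRing A₀] (e : Γ(X', ⊤) ≃+* A₀) (σ₀ : A₀ →+* A₀)
    (he : ∀ t : Γ(X', ⊤), e ((ρ g₀⁻¹).hom.appLE ⊤ ⊤ (by rw [Scheme.Hom.preimage_top]) t) = σ₀ (e t))
    {R : Type} [CommRing R] [IsRegularRing R] (eR : ↥(RingHom.eqLocus σ₀ (RingHom.id A₀)) ≃+* R)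
    (h₀ : NodeAtlas p (⟨ρ, hq⟩ : ActionOver q G) g₀) (𝔄₀ : NodeAtlasData p (GModel.initial hq h₀).act g₀) :
    ∃ P : ∀ M : GModel p q G ρ g₀, NodeAtlasData p M.act g₀ → Prop,
      P (GModel.initial hq h₀) 𝔄₀ ∧ ∀ (M : GModel p q G ρ g₀) (𝔄 : NodeAtlasData p M.act g₀), P M 𝔄 → ¬ M.Terminal →
        ∃ n : ℕ, TreeF P (fun N 𝔅 => LexLTF N 𝔅 M 𝔄) n M 𝔄 :=
  exists_reachLowerF_of_terminal _ 𝔄₀ (terminal_initial_of_fixedRing_equiv_regular hG hq e σ₀ he eR h₀)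

/-! ## Appendix (leafhand-res-wildquotients-9 g1, same session): `KillsIn 0` and `KillsIn n` for EVERY `n` discharge the stub's conclusion

✓`exists_reachLowerF_of_killsIn` (`…S1aKillFreeShots`) is stated for `KillsIn (n + 1)` — at least one move — because its tree needs a NON-EMPTY
root formal locus to compare against. The depth-`0` case goes through `Terminal` instead ((F-T0) ✓`terminal_of_fLocus_eq_empty` + the empty tree
`exists_reachLowerF_of_terminal`), so the kill route is now available for every depth `n : ℕ`. -/

/-- **`KillsIn 0` discharges the stub's conclusion** (Noetherian base): some node atlas with EMPTY carried formal locus makes the model terminal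
((F-T0) ✓`GModelBridge.terminal_of_fLocus_eq_empty`), and a terminal model inhabits `ReachLowerInF(X)` with the empty tree.
[OURS · L1 W4.5c · I-7; NOT a statement of the manuscript] -/
theorem exists_reachLowerF_of_killsIn_zero [Finite G] (hp : p.Prime) (hG : ∀ g : G, g ∈ Subgroup.zpowers g₀)
    (M₀ : GModel p q G ρ g₀) (hNB : M₀.HasNoetherianBase) (𝔄₀ : NodeAtlasData p M₀.act g₀) (h : KillsIn 0 M₀) :
    ∃ P : ∀ M : GModel p q G ρ g₀, NodeAtlasData p M.act g₀ → Prop,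
      P M₀ 𝔄₀ ∧ ∀ (M : GModel p q G ρ g₀) (𝔄 : NodeAtlasData p M.act g₀), P M 𝔄 → ¬ M.Terminal →
        ∃ n : ℕ, TreeF P (fun N 𝔅 => LexLTF N 𝔅 M 𝔄) n M 𝔄 := by
  obtain ⟨𝔄, h𝔄⟩ := (killsIn_zero_iff M₀).mp h
  exact exists_reachLowerF_of_terminal M₀ 𝔄₀ (GModelBridge.terminal_of_fLocus_eq_empty hG hp M₀ hNB 𝔄 h𝔄)

/-- ★ **`KillsIn n` discharges the stub's conclusion FOR EVERY `n : ℕ`** (all models of the datum with Noetherian base): `n = 0` by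
`exists_reachLowerF_of_killsIn_zero`, `n + 1` by ✓`exists_reachLowerF_of_killsIn`. [OURS · L1 W4.5c · I-7; NOT a statement of the manuscript] -/
theorem exists_reachLowerF_of_killsIn' [Finite G] (hp : p.Prime) (hG : ∀ g : G, g ∈ Subgroup.zpowers g₀)
    (hNB : ∀ M : GModel p q G ρ g₀, M.HasNoetherianBase) (M₀ : GModel p q G ρ g₀) (𝔄₀ : NodeAtlasData p M₀.act g₀) {n : ℕ}
    (h : KillsIn n M₀) :
    ∃ P : ∀ M : GModel p q G ρ g₀, NodeAtlasData p M.act g₀ → Prop,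
      P M₀ 𝔄₀ ∧ ∀ (M : GModel p q G ρ g₀) (𝔄 : NodeAtlasData p M.act g₀), P M 𝔄 → ¬ M.Terminal →
        ∃ n : ℕ, TreeF P (fun N 𝔅 => LexLTF N 𝔅 M 𝔄) n M 𝔄 := by
  cases n with
  | zero => exact exists_reachLowerF_of_killsIn_zero hp hG M₀ (hNB M₀) 𝔄₀ h
  | succ n => exact exists_reachLowerF_of_killsIn hp hG hNB M₀ 𝔄₀ h

/-- **The datum form, every depth `n`** (`hasNoetherianBase_of_datum`: `q` finite, `X₁ → Spec k′` locally of finite type).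
[OURS · L1 W4.5c · I-7; NOT a statement of the manuscript] -/
theorem exists_reachLowerF_of_killsIn_datum' [Finite G] (hp : p.Prime) (hG : ∀ g : G, g ∈ Subgroup.zpowers g₀)
    {k : Type} [Field k] (f : X₁ ⟶ Spec (.of k)) [LocallyOfFiniteType f] [IsFinite q]
    (M₀ : GModel p q G ρ g₀) (𝔄₀ : NodeAtlasData p M₀.act g₀) {n : ℕ} (h : KillsIn n M₀) :
    ∃ P : ∀ M : GModel p q G ρ g₀, NodeAtlasData p M.act g₀ → Prop,
      P M₀ 𝔄₀ ∧ ∀ (M : GModel p q G ρ g₀) (𝔄 : NodeAtlasData p M.act g₀), P M 𝔄 → ¬ M.Terminal →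
        ∃ n : ℕ, TreeF P (fun N 𝔅 => LexLTF N 𝔅 M 𝔄) n M 𝔄 :=
  exists_reachLowerF_of_killsIn' hp hG (hasNoetherianBase_of_datum f) M₀ 𝔄₀ h

end Summit.ResolutionOfSingularities.ResolutionOfSingularities.Theorems.WildQuotientResolution.S1.GameFrame.GModel

end
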